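import Literature.Computability.Complexity.AverageCaseDepthHierarchyAssembly
import Literature.Computability.Complexity.AverageCaseDepthHierarchyTypNum
import Literature.Computability.Complexity.CircuitComposition
import HarnessLib

/-!
# RST Theorem 1, assembled: the correlation bound for explicit parameters

B. Rossman, R. A. Servedio, L.-Y. Tan, *An average-case depth hierarchy theorem for Boolean
circuits*, arXiv:1504.03398 [RossmanServedioTan2015], §11.2 (pp. 37–38, proof of Theorem 6 ⇒
Theorem 1) with Proposition 1 (p. 19), Propositions 10–13 (pp. 32–36) and Lemma 17 (p. 35).

`agreement_le`: for `d = d'+1 ≥ 2`, a circuit `F` over `acBasis` on the `rstN m d` inputs of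
`Sipser_d` with `acDepth F ≤ d' = d-1` agrees with `balancedSipser m d` on at most
`(1/2 + errTot) · 2^{rstN m d}` inputs, where
`errTot = ε₀ + s t₁ + Σ_{j<d-1} (δT + |F| δP_{j+1})` collects the bias of the root after the last
stage (`ε₀`, from the window `(1-t₁)^{q w₀ ± Δ₀} = 1/2 ± ε₀`), the depth-`s` decision tree at the end
(`s t₁`), the typicality losses (`δT`, file `…TypNum`) and the projection switching lemma failures
(`δP`, with `Γ = λ/(16q³)`), GIVEN the elementary facts `RegimeFacts`/`TypFacts` about the
parameters. Everything here is bookkeeping: `ProcParams.V_ge` (the §11.2 chain) is fed with the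
RST process `rstProc m d`, the suppliers of the sibling files, and transported to circuits over
`Addr (rstFanins m d)` along `blkEquivRst`; `V_top_eq_uniform` (Prop. 1) turns the value of the
process at the top into the fraction of disagreements under the uniform distribution.
The sibling asymptotics file discharges the numeric facts for `m ≥ m₀`, `d ≤ c m / log m`.
-/

noncomputable section

namespace Literature.Computability.Complexity

namespace RSTProj

open Finset GateList

/-- The failure probability of the projection switching lemma at stage `k` with width `r`,
depth `s+1` and `Γ = λ/(16 q³)`. [cite: RossmanServedioTan2015, §10.1 Prop. 12 (p. 34)] -/
def δP (m d s k r : ℕ) : ℝ :=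
  ((8 * r + 10) * (1 + (rstLaw m d k).t / (1 - (rstLaw m d k).t)) ^ (r + 1) / (rstLam m / (16 * rstQ m ^ 3))) ^ (s + 1)

/-- The width schedule: `1` at the top stage (the circuit's input wires), `s` below. [cite: RossmanServedioTan2015, §11.2 (p. 37, `Ψ(g)` computed by depth-`s` trees)] -/
def depF (jtop s k : ℕ) : ℕ := if k = jtop then 1 else s

/-- The all-star restriction is typical at the top stage. [folklore] -/
theorem Typ_allStar_top (P : ProcParams) (E : ℕ) (lo hi : ℝ) {jtop : ℕ} (hj : 1 ≤ jtop) :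
    P.Typ E lo hi jtop jtop (P.allStar jtop) := by
  obtain ⟨j, rfl⟩ : ∃ j, jtop = j + 1 := ⟨jtop - 1, by omega⟩
  simp [ProcParams.Typ]

/-- Overwriting with the all-star restriction changes nothing. [folklore] -/
theorem ovw_allStar (P : ProcParams) (j : ℕ) (x : Blk P.W (j + 1) → Bool) : ovw (P.allStar j) x = x := by
  funext v; simp [ovw, ProcParams.allStar]

/-- **RST Theorem 1 for explicit parameters.** See the module docstring. [cite: RossmanServedioTan2015, Theorem 1 via §11.2 (pp. 37–38)] -/
theorem agreement_le {m d E s : ℕ} (hd : 2 ≤ d) (H : RegimeFacts m d) (T : TypFacts m d E) (hs : 1 ≤ s)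
    {ε₀ : ℝ} (hε₀ : 0 ≤ ε₀)
    (hb1 : 1 / 2 - ε₀ ≤ (1 - rstT m d 1) ^ (rstQ m * rstW0 m d + rstDelta m d 0))
    (hb2 : (1 - rstT m d 1) ^ (rstQ m * rstW0 m d - rstDelta m d 0) ≤ 1 / 2 + ε₀)
    (F : Circuit (Addr (rstFanins m d))) (hF : F.IsOver acBasis) (hdepth : F.acDepth ≤ d - 1) :
    (((univ : Finset (Addr (rstFanins m d) → Bool)).filter
        fun x => F.eval x = balancedSipser m d x).card : ℝ) ≤
      (1 / 2 + ProcParams.errTot ε₀ (s * rstT m d 1) (fun _ => δT m d E)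
          (fun k => δP m d s k (depF (d - 1) s k)) F.size (d - 1)) * 2 ^ rstN m d := by
  classical
  obtain ⟨d', rfl⟩ : ∃ d', d = d' + 1 := ⟨d - 1, by omega⟩
  have hd' : 1 ≤ d' := by omega
  simp only [Nat.add_sub_cancel] at hdepth ⊢
  have hd2 : 2 ≤ d' + 1 := by omega
  have hq := rstQ_pos m
  -- consistency of the parameters
  have hT : ∀ k, 1 ≤ k → k ≤ d' + 1 - 1 → 0 < rstT m (d' + 1) k ∧ rstT m (d' + 1) k < 1 := fun k h1 h2 =>
    ⟨(H.t_mem h1 h2).1, (H.t_mem h1 h2).2.2⟩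
  have hlamp : rstLam m < rstP m := by have := H.lam_le; rw [rstQ_sq] at this; linarith [rstP_pos m]
  have hpq : rstP m < rstQ m := by
    rw [← rstQ_sq, sq]; exact mul_lt_of_lt_one_left hq (by linarith [H.q_le])
  have hP : (rstProc m (d' + 1)).Consistent := rstProc_consistent hd2 hT hlamp hpq
  have ht1eq : ((rstProc m (d' + 1)).law 0).t = rstT m (d' + 1) 1 := by
    show rstTk m (d' + 1) (0 + 1) = _; unfold rstTk; rw [if_neg (by omega)]
  -- the inputs of `V_ge`
  set P := rstProc m (d' + 1) with hPdef
  set lo := rstQ m * rstW0 m (d' + 1) - rstDelta m (d' + 1) 0 with hlo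
  set hi := rstQ m * rstW0 m (d' + 1) + rstDelta m (d' + 1) 0 with hhi
  set Typ : (j : ℕ) → BRestr (Blk P.W j) (Fin (P.W j)) → Prop := P.Typ E lo hi d' with hTyp
  set dep : ℕ → ℕ := depF d' s with hdep
  have hdep1 : ∀ j, 1 ≤ dep j := fun j => by rw [hdep, depF]; split_ifs <;> omega
  have hdeps : ∀ j, dep j ≤ s := fun j => by rw [hdep, depF]; split_ifs <;> omega
  have hdeplt : ∀ j, j < d' → dep j = s := fun j hj => by rw [hdep, depF, if_neg (by omega)]
  have hΓ : 0 < rstLam m / (16 * rstQ m ^ 3) := div_pos H.lam_pos (by positivity)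
  have hδT : 0 ≤ δT m (d' + 1) E := by
    unfold δT
    have := rstLam_nonneg m
    positivity
  have hδP : ∀ k, 0 ≤ δP m (d' + 1) s k (dep k) := by
    intro k
    unfold δP
    apply pow_nonneg
    apply div_nonneg _ hΓ.le
    apply mul_nonneg (by positivity)
    apply pow_nonneg
    have h0 := hP.t_pos k
    have h1 := hP.t_le_one k
    have : 0 ≤ (P.law k).t / (1 - (P.law k).t) := div_nonneg h0.le (by linarith)
    show 0 ≤ 1 + ((rstProc m (d' + 1)).law k).t / (1 - ((rstProc m (d' + 1)).law k).t)
    linarith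
  -- (hpsl) the projection switching lemma at every stage
  have hpsl : ∀ (j : ℕ) (τ : BRestr (Blk P.W (j + 1)) (Fin (P.W (j + 1)))), j < d' → Typ (j + 1) τ →
      ∀ F' : CNF (Blk P.W (j + 1) × Fin (P.W (j + 1))), (∀ T ∈ F', VarNodup T) →
        (∀ T ∈ F', T.length ≤ dep (j + 1)) →
        ∑ ρ ∈ univ.filter (fun ρ => s + 1 ≤ pcdt F' ρ), (P.law (j + 1)).R τ ρ ≤ δP m (d' + 1) s (j + 1) (dep (j + 1)) := by
    intro j τ hj _ F' hF' hr
    have ht0 : 0 < (P.law (j + 1)).t := hP.t_pos (j + 1)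
    have ht2 : (P.law (j + 1)).t ≤ 1 / 2 := by
      show rstTk m (d' + 1) (j + 1 + 1) ≤ 1 / 2
      unfold rstTk
      split_ifs with h
      · exact le_rfl
      · exact (H.t_mem (k := j + 1 + 1) (by omega) (by omega)).2.1
    have hqa : ∀ n, (P.law (j + 1)).acc n = true → 1 ≤ n →
        0 < (P.law (j + 1)).qa n ∧ (P.law (j + 1)).qa n ≤ 1 - (P.law (j + 1)).lam ∧
          rstLam m / (16 * rstQ m ^ 3) * (P.law (j + 1)).qa n ≤ 1 - (P.law (j + 1)).lam - (P.law (j + 1)).qa n ∧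
          rstLam m / (16 * rstQ m ^ 3) * (P.law (j + 1)).qa n * (1 - (P.law (j + 1)).t) ^ n ≤
            (P.law (j + 1)).lam * (1 - (1 - (P.law (j + 1)).t) ^ n) := by
      by_cases htop : j + 1 = d'
      · have h := H.pslHyp_top
        have e : d' + 1 - 1 = j + 1 := by omega
        rw [e] at h
        exact h
      · exact H.pslHyp_mid (k := j + 1) (by omega) (by omega)
    exact (P.law (j + 1)).psl_level ht0 ht2 (rstLam_nonneg m) hΓ hqa τ F' hF' hr (s := s + 1) (by omega)
  -- (htyp) typicality is preserved
  have htyp : ∀ (j : ℕ) (τ : BRestr (Blk P.W (j + 1)) (Fin (P.W (j + 1)))), j < d' → Typ (j + 1) τ →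
      ∑ ρ ∈ univ.filter (fun ρ => ¬ Typ j (liftR (P.law (j + 1)).o ρ)), (P.law (j + 1)).R τ ρ ≤ δT m (d' + 1) E := by
    have h := htyp_rst H T
    simp only [Nat.add_sub_cancel] at h
    exact h
  -- (htyp0), (hbase): the last stage
  have htyp0 : ∀ τ : BRestr (Blk P.W 0) (Fin (P.W 0)), Typ 0 τ → ∀ i c, τ default i = some c → c = (P.law 0).o := by
    intro τ hτ i c hc
    have h1 : τ default i ≠ some (!(P.law 0).o) := hτ.1 i
    rw [hc] at h1
    cases c <;> cases ho : (P.law 0).o <;> simp_all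
  have hbase : ∀ τ : BRestr (Blk P.W 0) (Fin (P.W 0)), Typ 0 τ →
      1 / 2 - ε₀ ≤ min
        (∑ za : Fin (P.W 0) → Bool, prodLaw (fun i b => ProcParams.pw (P.law 0) (τ default i) b) za *
          (if gate ((P.law 0).o) (fun i => (τ default i).getD (za i)) = (P.law 0).o then 1 else 0))
        (∑ za : Fin (P.W 0) → Bool, prodLaw (fun i b => ProcParams.pw (P.law 0) (τ default i) b) za *
          (if gate ((P.law 0).o) (fun i => (τ default i).getD (za i)) = !(P.law 0).o then 1 else 0)) := by
    intro τ hτ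
    have hF : P.TypFin lo hi τ := hτ
    have ht0 : 0 ≤ (P.law 0).t := (hP.t_pos 0).le
    have ht1 : (P.law 0).t < 1 := by rw [ht1eq]; exact (hT 1 le_rfl (by omega)).2
    refine base_bias (P.law 0) ht0 ht1 (τ default) (htyp0 τ hτ) hF.2.1 hF.2.2 ?_ ?_
    · rw [ht1eq]; exact hb1
    · rw [ht1eq]; exact hb2
  -- the circuit
  have hwf := wf_gates F
  have hht : wireHt F.gates F.output ≤ d' := by rw [← circuit_acDepth_eq_wireHt]; exact hdepth
  let e : Addr (rstFanins m (d' + 1)) → Blk P.W d' × Fin (P.W d') := fun i => (blkEquivRst hd2 m).symm i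
  have hInv : InvE F.gates (fun (x : Blk P.W d' × Fin (P.W d') → Bool) i => x (e i)) (d' - d') (dep d') := by
    rw [Nat.sub_self, show dep d' = 1 from if_pos rfl]
    exact invE_zero hwf hF e
  have hTop : Typ d' (P.allStar d') := Typ_allStar_top P E lo hi hd'
  -- the chain of inequalities
  have main := ProcParams.V_ge (P := P) (o := fun j => (P.law j).o) hP (fun j => rfl)
    (fun j τ ρ => H.R_nonneg_all hT j τ ρ) hwf hF F.wf_output hht Typ dep hdep1 hdeps hdeplt
    (δtyp := fun _ => δT m (d' + 1) E) (δpsl := fun k => δP m (d' + 1) s k (dep k)) (fun _ => hδT) hδP hε₀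
    (t := rstT m (d' + 1) 1) (hT 1 le_rfl (by omega)).1.le hpsl htyp htyp0 (le_of_eq ht1eq) hbase d' le_rfl (P.allStar d')
    (fun x i => x (e i)) hTop hInv
  -- the value at the top is the fraction of disagreements (Prop. 1)
  have ht12 : (P.law d').t = 1 / 2 := by
    have := rstProc_t_top (m := m) (d := d' + 1) (by omega)
    have e1 : d' + 1 - 1 = d' := by omega
    rwa [e1] at this
  rw [P.V_top_eq_uniform hP ht12] at main
  -- identify the disagreement set with the one over `Addr`
  have hcard : Fintype.card (Blk P.W d' × Fin (P.W d')) = rstN m (d' + 1) := by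
    rw [← card_addr_rstFanins m (d' + 1), ← Fintype.card_congr (blkEquivRst hd2 m)]; rfl
  let Φ : (Addr (rstFanins m (d' + 1)) → Bool) ≃ (Blk P.W d' × Fin (P.W d') → Bool) :=
    Equiv.arrowCongr (blkEquivRst hd2 m).symm (Equiv.refl Bool)
  have hΦ : ∀ v b, Φ v b = v (blkEquivRst hd2 m b) := fun v b => rfl
  have htgt : ∀ X : Blk P.W d' × Fin (P.W d') → Bool,
      P.tgt (fun j => (P.law j).o) d' (P.allStar d') X = sipserK (W := rstWseq m (d' + 1)) (altPol (Nat.bodd (d' + 1))) (d' + 1) X := by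
    intro X
    show sipserK (W := P.W) (fun j => (P.law j).o) (d' + 1) (ovw (P.allStar d') X) = _
    rw [ovw_allStar]
    rfl
  have hdis : ((univ.filter fun X : Blk P.W d' × Fin (P.W d') → Bool =>
        P.tgt (fun j => (P.law j).o) d' (P.allStar d') X ≠ wireFn F.gates F.output (fun i => X (e i))).card : ℝ) =
      ((univ.filter fun v : Addr (rstFanins m (d' + 1)) → Bool => ¬ (F.eval v = balancedSipser m (d' + 1) v)).card : ℝ) := by
    congr 1
    rw [← Finset.map_univ_equiv Φ, Finset.filter_map, Finset.card_map]
    congr 1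
    refine Finset.filter_congr fun v _ => ?_
    simp only [Function.comp_apply, Equiv.coe_toEmbedding]
    rw [htgt, balancedSipser_eq_sipserK hd2, ← circuit_eval_eq_wireFn]
    have e1 : (fun i => Φ v (e i)) = v := by
      funext i; rw [hΦ]; exact congrArg v ((blkEquivRst hd2 m).apply_symm_apply i)
    have e2 : (fun b => v ((blkEquivRst hd2 m) b)) = Φ v := by funext b; rw [hΦ]
    rw [e1, e2]
    exact ⟨fun h h' => h h'.symm, fun h h' => h h'.symm⟩
  rw [hdis, hcard] at main
  -- conclude
  have htot : ((univ.filter fun v : Addr (rstFanins m (d' + 1)) → Bool => F.eval v = balancedSipser m (d' + 1) v).card : ℝ) +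
      ((univ.filter fun v : Addr (rstFanins m (d' + 1)) → Bool => ¬ (F.eval v = balancedSipser m (d' + 1) v)).card : ℝ) =
      2 ^ rstN m (d' + 1) := by
    rw [← Nat.cast_add, Finset.card_filter_add_card_filter_not, Finset.card_univ, Fintype.card_fun,
      Fintype.card_bool, card_addr_rstFanins]
    push_cast; ring
  have h2 : (0 : ℝ) < 2 ^ rstN m (d' + 1) := by positivity
  rw [le_div_iff₀ h2] at main
  rw [show F.size = F.gates.length from rfl]
  linarith

end RSTProj

end Literature.Computability.Complexity

end
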